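import Summits.QuantumFields.YangMills.Theorems.BalabanUVNodesN21ThresholdMixtureCommonBoxRelWeight
import Summits.QuantumFields.YangMills.Theorems.BalabanUVNodesN21AtSpineCarriersSanity

/-!
# YM-DAG node N21 (= NE7c) — THE THRESHOLD MIXTURE, PART 6′: vacuity guard for the N20 face of the mixture carriers — a two-point field law with
# a genuinely POSITIVE, SUMMABLE bad fraction inhabits `s_N20_of_sharpCommonBoxReading`'s package, and `S_N20` FIRES on it

Track A of `YM-PLAN.md` (cell `pub-ymgap`, HUMAN RULING D-0062), node **N21** (its N20 in-edge on the mixture road); R141 (C) fan-out seat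
`pub-ymgap-dag-n21-e` (s3 = ALTERNATIVE CURRENCY), generation 3, file 12′ (guard of file 12 `…N21ThresholdMixtureCommonBoxRelWeight`).  Kernel
bookkeeping on a TOY: 0 `def`, 0 `sorry`, standard axioms.  COUNT-NEUTRAL; `--supports` the K3′ item `SpineGivenEndpointR12` as a helper.

THE TOY (A2 junk-pin guard — the bad fraction is NOT zero).  Per step `K`: ONE occurrence (age `0`, threshold `1`, width `κ = 1∕2`) read by TWO terms
`true ↦ χ`, `false ↦ 1 − χ` (`e = id`); the field space is TWO POINTS with the law `(1 − w_K)·δ_low + w_K·δ_high`, `w_K = (1∕2)^K∕4`, the tested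
variable `1∕4` at `low` and `2` at `high` — OUTSIDE the threshold slack `[1∕2, 1]`, so the SHARP weights are threshold-INDEPENDENT on the box:
`Xs_true ≡ 1 − w_K`, `Xs_false ≡ w_K` (`toy_sharp_eq`); the bad class `{false}` has relative sharp weight EXACTLY `w_K` at every threshold assignment
(`Σ_T Xs = 1`), `0 < w_K < 1`, `Σ_K w_K < ∞`; the carriers ARE the normalised box averages (pinned literally); both runs coincide.  A toy, NOT Bałaban's
terms; NOTHING of N20 is proved by it.

HONEST FRAMING.  Nothing of Bałaban's is asserted; NE7b ∕ NE7c NOT PRINTED as ratio statements ∕ NOT proved; N20 ∕ N21 NOT discharged; count-neutral;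
one finite four-torus programme at fixed `ε`; NOT continuum ∕ ℝ⁴ ∕ OS ∕ mass gap ∕ Clay.

CITATION HEADER (lean-in-tree rule 2026-08-18).  BY NAME: file 12 `s_N20_of_sharpCommonBoxReading`; file 10a `ae_mem_box_pi`; `T4LipschitzLedger.Pol`;
`T4IndicatorShell.smallInd`; pv07's `T4LipschitzLedger.Sanity.half_pow_pos ∕ half_pow_le_one`; `…ClustersCore` (`SpineCarriers`, `SpineRecordPred`, `S_N20`);
`…N21AtSpineCarriers.exists_family_and_datum`; Mathlib `integral_add_measure`, `integral_smul_nnreal_measure`, `integral_dirac`, `Integrable.of_finite`.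

WHAT IS PROVED ([folklore]).  `toy2_integral`, `toy_smallInd_low`, `toy_smallInd_high`, `toy_sharp_eq`, `toy_quarter_lt_one`,
**`s_N20_fires_on_sharpCommonBoxReading`**.
-/

set_option autoImplicit false

noncomputable section

open MeasureTheory Set
open scoped BigOperators ENNReal NNReal

namespace Summit.QuantumFields.YangMills.Theorems.N21ThresholdMixtureCommonBoxRelWeightSanity

open YMDAG.UVSplit (SpineCarriers SpineRecordPred S_N20)
open Literature.MathematicalPhysics.QuantumFieldTheory.Balaban1983to89
open Literature.MathematicalPhysics.QuantumFieldTheory.Balaban1983to89.T4IndicatorShell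
open Literature.MathematicalPhysics.QuantumFieldTheory.Balaban1983to89.T4LipschitzLedger
open T4LipschitzLedger.Sanity (half_pow_pos half_pow_le_one)
open N21ThresholdMixtureCommonBoxRelWeight (s_N20_of_sharpCommonBoxReading)

/-! ## Toy letters -/

/-- integration against the two-point law `(1 − w)·δ_false + w·δ_true` (`0 ≤ w ≤ 1`). [folklore] -/
theorem toy2_integral {w : ℝ} (hw0 : 0 ≤ w) (hw1 : w ≤ 1) (f : Bool → ℝ) :
    ∫ v, f v ∂((1 - w).toNNReal • Measure.dirac false + w.toNNReal • Measure.dirac true) = (1 - w) * f false + w * f true := by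
  rw [integral_add_measure Integrable.of_finite Integrable.of_finite, integral_smul_nnreal_measure, integral_smul_nnreal_measure,
    integral_dirac, integral_dirac, NNReal.smul_def, NNReal.smul_def, Real.coe_toNNReal _ (by linarith), Real.coe_toNNReal _ hw0, smul_eq_mul,
    smul_eq_mul]

/-- the LOW field value `1∕4` is below every threshold of the slack `[1∕2, 1]`. [folklore] -/
theorem toy_smallInd_low {s : ℝ} (hs : s ∈ Icc ((1 - (1 / 2 : ℝ)) * 1) 1) : smallInd (1 / 4 : ℝ) s = 1 := by
  unfold smallInd
  rw [if_pos]
  have := hs.1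
  linarith

/-- the HIGH field value `2` is above every threshold of the slack. [folklore] -/
theorem toy_smallInd_high {s : ℝ} (hs : s ∈ Icc ((1 - (1 / 2 : ℝ)) * 1) 1) : smallInd (2 : ℝ) s = 0 := by
  unfold smallInd
  rw [if_neg]
  have := hs.2
  linarith

/-- **THE SHARP WEIGHTS OF THE TOY ARE THRESHOLD-INDEPENDENT ON THE BOX**: `Xs_true(s) = 1 − w`, `Xs_false(s) = w` for every `s ∈ [1∕2, 1]`. [folklore] -/
theorem toy_sharp_eq {w : ℝ} (hw0 : 0 ≤ w) (hw1 : w ≤ 1) (b : Bool) {s : Fin 1 → ℝ} (hs : ∀ c : Fin 1, s c ∈ Icc ((1 - (1 / 2 : ℝ)) * 1) 1) :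
    ∫ v, (∏ i : Fin 1, (cond b Pol.small Pol.large).fac (smallInd (cond v (2 : ℝ) (1 / 4)) (s i))) * (1 : ℝ)
        ∂((1 - w).toNNReal • Measure.dirac false + w.toNNReal • Measure.dirac true) = cond b (1 - w) w := by
  rw [toy2_integral hw0 hw1]
  simp only [Fin.prod_univ_one, Bool.cond_false, Bool.cond_true, mul_one, toy_smallInd_low (hs 0), toy_smallInd_high (hs 0)]
  cases b <;> simp only [Bool.cond_true, Bool.cond_false, Pol.fac_small, Pol.fac_large]
  · ring
  · ring

/-- `(1∕2)^K∕4 < 1`. [folklore] -/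
theorem toy_quarter_lt_one (K : ℕ) : (1 / 2 : ℝ) ^ K / 4 < 1 := by
  have := half_pow_le_one K
  linarith

/-! ## The N20 face of the mixture carriers is inhabited with a positive bad fraction, and `S_N20` FIRES on it -/

/-- **THE COMMON-BOX SHARP-MIXTURE READING OF THE BAD-CLASS BOUNDS IS INHABITED NON-DEGENERATELY AND `S_N20` FIRES ON IT.**  There is a carrier
predicate `SRec` over `SU(2)` data such that (i) `SRec` is file 12's reading predicate — every bundle it pins carries EXACTLY the package of
`s_N20_of_sharpCommonBoxReading`; (ii) it is INHABITED by the two-point toy above: nonempty classes, a NONEMPTY bad class `{false}` whose sharp relative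
weight is EXACTLY `w_K = (1∕2)^K∕4 > 0` at every threshold assignment of the box (so the bound is used with equality, not vacuously), `W K = w_K` with
`0 < W K < 1` summable, carriers pinned as the normalised box averages; (iii) `S_N20 SRec` (file 12 §3).  A toy, NOT Bałaban's terms; N20's bound for
print's expansion is NOT touched. [folklore] -/
theorem s_N20_fires_on_sharpCommonBoxReading :
    ∃ SRec : SpineRecordPred 2,
      (∃ (F : T4Continuum.T4Family) (D : YMDAG.UVSplit.Datum F 2) (g₀ : ℕ → ℝ) (os : List (T4Continuum.ULoop F))
          (S : SpineCarriers), SRec F D g₀ os S ∧ (∀ K, (S.T K).Nonempty) ∧ (∀ K t, (S.Bad K t).Nonempty) ∧ (∀ K, 0 < S.W K)) ∧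
      S_N20 SRec := by
  obtain ⟨F, ⟨Dat⟩⟩ := N21AtSpineCarriers.exists_family_and_datum
  have hw0 : ∀ K : ℕ, (0 : ℝ) ≤ (1 / 2 : ℝ) ^ K / 4 := fun K => by positivity
  have hw1 : ∀ K : ℕ, (1 / 2 : ℝ) ^ K / 4 ≤ 1 := fun K => (toy_quarter_lt_one K).le
  have hsumW : Summable fun K : ℕ => (1 / 2 : ℝ) ^ K / 4 :=
    (summable_geometric_of_lt_one (by norm_num) (by norm_num : (1 / 2 : ℝ) < 1)).div_const 4
  refine ⟨_, ?_, s_N20_of_sharpCommonBoxReading (N := 2) _ fun _ _ _ _ _ h => h⟩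
  refine ⟨F, Dat, fun _ => 0, [],
    { ι := Bool, l₀ := 1, vol := 1, K₀ := 0, T := fun _ => Finset.univ,
      A := fun K t b => (∏ _i : Fin 1, ((1 / 2 : ℝ) * 1))⁻¹ *
        ∫ s, (∫ v, (∏ i : Fin 1, (cond b Pol.small Pol.large).fac (smallInd (cond v (2 : ℝ) (1 / 4)) (s i))) * (1 : ℝ)
          ∂((1 - (1 / 2 : ℝ) ^ K / 4).toNNReal • Measure.dirac false + ((1 / 2 : ℝ) ^ K / 4).toNNReal • Measure.dirac true))
          ∂(Measure.pi fun _ : Fin 1 => volume.restrict (Icc ((1 - (1 / 2 : ℝ)) * 1) 1)),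
      B := fun K t b => (∏ _i : Fin 1, ((1 / 2 : ℝ) * 1))⁻¹ *
        ∫ s, (∫ v, (∏ i : Fin 1, (cond b Pol.small Pol.large).fac (smallInd (cond v (2 : ℝ) (1 / 4)) (s i))) * (1 : ℝ)
          ∂((1 - (1 / 2 : ℝ) ^ K / 4).toNNReal • Measure.dirac false + ((1 / 2 : ℝ) ^ K / 4).toNNReal • Measure.dirac true))
          ∂(Measure.pi fun _ : Fin 1 => volume.restrict (Icc ((1 - (1 / 2 : ℝ)) * 1) 1)),
      shA := fun _ _ _ => 0, shB := fun _ _ _ => 0, Bad := fun _ _ => {false}, W := fun K => (1 / 2 : ℝ) ^ K / 4,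
      Wsh := fun _ => 0, δ := fun _ => 0 }, ?_, ?_, ?_, ?_⟩
  · -- the package of file 12 §3 at the toy data
    refine ⟨fun _ _ => Bool, inferInstance,
      fun K _ => (1 - (1 / 2 : ℝ) ^ K / 4).toNNReal • Measure.dirac false + ((1 / 2 : ℝ) ^ K / 4).toNNReal • Measure.dirac true,
      fun _ _ => inferInstance, fun _ => 1 / 2, fun _ _ => 1, fun _ _ _ => ⟨0, 0⟩, fun _ b _ => cond b Pol.small Pol.large, fun _ _ _ => 1,
      fun _ _ _ v => cond v (2 : ℝ) (1 / 4), fun _ _ _ v => cond v (2 : ℝ) (1 / 4), fun _ _ _ _ => 1, fun _ _ _ _ => 1,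
      fun K t b s => ∫ v, (∏ i : Fin 1, (cond b Pol.small Pol.large).fac (smallInd ((fun v : Bool => cond v (2 : ℝ) (1 / 4)) v) (s i))) *
        (fun (_ : Bool) => (1 : ℝ)) v
          ∂((1 - (1 / 2 : ℝ) ^ K / 4).toNNReal • Measure.dirac false + ((1 / 2 : ℝ) ^ K / 4).toNNReal • Measure.dirac true),
      fun K t b s => ∫ v, (∏ i : Fin 1, (cond b Pol.small Pol.large).fac (smallInd ((fun v : Bool => cond v (2 : ℝ) (1 / 4)) v) (s i))) *
        (fun (_ : Bool) => (1 : ℝ)) v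
          ∂((1 - (1 / 2 : ℝ) ^ K / 4).toNNReal • Measure.dirac false + ((1 / 2 : ℝ) ^ K / 4).toNNReal • Measure.dirac true),
      fun _ => 1, fun _ _ => 0, fun _ _ => 1, fun _ _ j => j,
      fun _ => by norm_num, fun _ _ _ _ _ => ⟨Measurable.of_discrete, Measurable.of_discrete⟩,
      fun _ _ _ _ _ => Integrable.of_finite, fun _ _ _ _ _ => Integrable.of_finite,
      fun _ _ _ _ _ _ => rfl, fun _ _ _ _ _ _ => rfl, fun _ _ _ _ _ => rfl, fun _ _ _ _ _ => rfl,
      fun _ _ => one_pos, fun _ _ _ => fun a b h => h, fun _ _ _ _ => rfl, fun _ _ _ _ => rfl,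
      fun _ _ _ => Finset.subset_univ _, hw0, toy_quarter_lt_one, hsumW, ?_, ?_⟩
    · -- run A: the bad class `{false}` has sharp relative weight EXACTLY `w_K` at every threshold assignment of the box
      intro K t _ Sv hSv
      show ∑ b ∈ ({false} : Finset Bool), ∫ v, (∏ i : Fin 1, (cond b Pol.small Pol.large).fac (smallInd (cond v (2 : ℝ) (1 / 4)) (Sv i))) * (1 : ℝ)
            ∂((1 - (1 / 2 : ℝ) ^ K / 4).toNNReal • Measure.dirac false + ((1 / 2 : ℝ) ^ K / 4).toNNReal • Measure.dirac true) ≤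
        (1 / 2 : ℝ) ^ K / 4 * ∑ b : Bool, ∫ v, (∏ i : Fin 1, (cond b Pol.small Pol.large).fac (smallInd (cond v (2 : ℝ) (1 / 4)) (Sv i))) *
          (1 : ℝ) ∂((1 - (1 / 2 : ℝ) ^ K / 4).toNNReal • Measure.dirac false + ((1 / 2 : ℝ) ^ K / 4).toNNReal • Measure.dirac true)
      rw [Finset.sum_singleton, Fintype.sum_bool, toy_sharp_eq (hw0 K) (hw1 K) false hSv, toy_sharp_eq (hw0 K) (hw1 K) true hSv]
      simp only [Bool.cond_true, Bool.cond_false]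
      linarith
    · -- run B (the same run)
      intro K t _ Sv hSv
      show ∑ b ∈ ({false} : Finset Bool), ∫ v, (∏ i : Fin 1, (cond b Pol.small Pol.large).fac (smallInd (cond v (2 : ℝ) (1 / 4)) (Sv i))) * (1 : ℝ)
            ∂((1 - (1 / 2 : ℝ) ^ K / 4).toNNReal • Measure.dirac false + ((1 / 2 : ℝ) ^ K / 4).toNNReal • Measure.dirac true) ≤
        (1 / 2 : ℝ) ^ K / 4 * ∑ b : Bool, ∫ v, (∏ i : Fin 1, (cond b Pol.small Pol.large).fac (smallInd (cond v (2 : ℝ) (1 / 4)) (Sv i))) *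
          (1 : ℝ) ∂((1 - (1 / 2 : ℝ) ^ K / 4).toNNReal • Measure.dirac false + ((1 / 2 : ℝ) ^ K / 4).toNNReal • Measure.dirac true)
      rw [Finset.sum_singleton, Fintype.sum_bool, toy_sharp_eq (hw0 K) (hw1 K) false hSv, toy_sharp_eq (hw0 K) (hw1 K) true hSv]
      simp only [Bool.cond_true, Bool.cond_false]
      linarith
  · intro K
    exact ⟨true, Finset.mem_univ _⟩
  · intro K t
    exact ⟨false, Finset.mem_singleton_self _⟩
  · intro K
    exact div_pos (half_pow_pos K) (by norm_num)

end Summit.QuantumFields.YangMills.Theorems.N21ThresholdMixtureCommonBoxRelWeightSanity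

end
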